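import Literature.NumberTheory.LFunctions.Zhang2022.Section10Lemma101MainRanges
import HarnessLib

/-!
# Zhang (2022), Lemma 10.1 (`Z22:Lem10.1`): the skeleton node `Lemma101 c′` HOLDS, part 5/5

Topic `Literature/NumberTheory/LFunctions/Zhang2022` (Landau–Siegel audit tree; verdict-neutral).
Y. Zhang, *Discrete mean estimates and the Landau–Siegel zero*, arXiv:2211.02515v1 (2022)
[Zhang2022LandauSiegel] — **an unrefereed manuscript under adjudication**; this file proves one of
its lemmas from the manuscript's own definitions and asserts nothing about its Theorems 1–2.
Cell siegel-zhang (D-0069 width campaign), discharge of DAG node `Z22:Lem10.1` / proof node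
`Z22:Lem10.1.pf` [Z22 pp. 53–54, (10.2)–(10.7), tex L2723–2788], skeleton node
`Skeleton.Lemma101 c′` (`SkeletonPartTwo`), cone C24 of `theorem1_of_leaves`.

> **Lemma 10.1.** Write `𝔳₁ⱼ(y) = Σ_m χ(m)f̃(log(ym)/log P)m^{−(1−β_j)}`. If `1 ≤ y ≤ P^{0.5}/T`, then
> `𝔳₁ⱼ(y) ≪ T^{−c}` (10.2); if `P^{0.5} < y ≤ P^{0.502}/T`, then
> `𝔳₁ⱼ(y) = (500L′(1,χ)/log P)(−1 − β_j log(y/P^{0.5})) + O(𝓛⁻¹⁵)` (10.3); if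
> `P^{0.502} < y ≤ P^{0.504}/T`, then `𝔳₁ⱼ(y) = (500L′(1,χ)/log P)(1 − β_j log(P^{0.504}/y)) + O(𝓛⁻¹⁵)`
> (10.4); if `y ∈ (P^{0.5}/T, P^{0.5}] ∪ (P^{0.502}/T, P^{0.502}] ∪ (P^{0.504}/T, P^{0.504})`, then
> `𝔳₁ⱼ(y) ≪ 𝓛⁻⁷` (10.5).

Content: **(10.5)** `range_four` (each of the three Riesz means is `O(𝓛²)`, times `500/log P`),
**(10.2)** `range_one` with `c = 1/2` (only `m > P^{0.5}/y ≥ T` carry a non-zero weight; Abel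
summation with Pólya–Vinogradov, tree `CharacterTails.norm_window_le_polyaVinogradov`, gives
`≪ √D log D/T ≤ 20T^{−1/2}`), and the assembly `lemma101_holds : 0 ≤ c′ → Skeleton.Lemma101 c′`
under the node's standing quantifier `ForAllLarge` (`D ≥ exp(1024 + (3+5c′)π)`) and (A) — no
other hypothesis; axioms standard. Parts 1–4: `Section10Lemma101Tent`, `…Weights`, `…ShortMeans`,
`…MainRanges`.

## References
* Y. Zhang, arXiv:2211.02515v1 (2022), §10 Lemma 10.1 (10.2)–(10.5), proof pp. 53–54.
  [cite: Zhang2022LandauSiegel, §10 Lemma 10.1]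
* H. L. Montgomery, R. C. Vaughan, *Multiplicative Number Theory I*, CUP 2007, §9.4 Thm. 9.18.
  [cite: MontgomeryVaughan2007, §9.4]
-/

noncomputable section

open Complex Real

namespace Literature.NumberTheory.LFunctions.Zhang2022.Lemma101

open Literature.NumberTheory.LFunctions.Zhang2022.Skeleton
open Literature.NumberTheory.LFunctions.Zhang2022.Lemma82 (twist C82)

variable {D : ℕ} (χ : DirichletCharacter ℂ D)

/-- **(10.5)**: on the three windows `(P^a/T, P^a]`, `𝔳₁ⱼ(y) ≪ 𝓛⁻⁷` (indeed for every
`y > P^{0.5}/T`: each of the three Riesz means is `O(𝓛²)`).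
[cite: Zhang2022LandauSiegel, §10 Lemma 10.1 (10.5)] -/
theorem range_four [NeZero D] (hprim : χ.IsPrimitive) {c' : ℝ} (hc' : 0 ≤ c')
    (hL : 1024 + (3 + 5 * c') * π ≤ Real.log D) (hA : ‖χ.LFunction 1‖ ≤ 1 / Real.log D ^ 2022)
    {j : ℕ} (hj : j ∈ ({1, 2, 3} : Finset ℕ)) {y : ℝ} (hy : bigP D ^ (0.5 : ℝ) / bigT D < y) :
    ‖frakv1 c' χ j y‖ ≤ 2000 * (5 + 4 * (3 + 5 * c') * π +
      4 * Real.exp (9 / 2) * (1 + (3 + 5 * c') * π) + C82 (3 + 5 * c')) / Real.log D ^ 7 := by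
  obtain ⟨hlogP, hT, hPa⟩ := params D
  obtain ⟨hL200, hL3, hP1, hδre, hδn, hK4, hT9⟩ := setting (D := D) hc' hL hj
  have hK0 : 0 ≤ 3 + 5 * c' := by positivity
  set L : ℝ := Real.log D with hLdef
  set β : ℂ := betaJ c' D j with hβdef
  set CU : ℝ := 5 + 4 * (3 + 5 * c') * π + 4 * Real.exp (9 / 2) * (1 + (3 + 5 * c') * π) +
    C82 (3 + 5 * c') with hCU
  have hL0 : 0 < L := by linarith
  have hP0 : 0 < bigP D := by linarith
  have hPa0 : ∀ a : ℝ, 0 < bigP D ^ a := fun a => Real.rpow_pos_of_pos hP0 a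
  have hT0 : 0 < bigT D := by rw [hT]; exact Real.exp_pos _
  have hy1 : 1 ≤ y := by
    refine le_trans ?_ hy.le
    rw [le_div_iff₀ hT0, one_mul, hT, hPa]
    exact Real.exp_le_exp.mpr (by linarith)
  have hy0 : 0 < y := by linarith
  have hXP : ∀ a : ℝ, a ≤ 1 → 0 < bigP D ^ a / y ∧ bigP D ^ a / y ≤ Real.exp (L ^ 9) := by
    intro a ha
    refine ⟨by positivity, ?_⟩
    calc bigP D ^ a / y ≤ bigP D ^ a := div_le_self (hPa0 a).le hy1
      _ = Real.exp (a * L ^ 9) := hPa a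
      _ ≤ Real.exp (L ^ 9) := Real.exp_le_exp.mpr (by nlinarith [pow_pos hL0 9])
  have hb : ∀ a : ℝ, a ≤ 1 → ‖∑ m ∈ Finset.Ioc 0 ⌊bigP D ^ a / y⌋₊, twist χ (-β) m *
      (Real.log (bigP D ^ a / y / m) : ℂ)‖ ≤ CU * L ^ 2 := fun a ha =>
    norm_riesz_le χ hprim hK0 hL200 hA hδre hδn (hXP a ha).1 (hXP a ha).2
  rw [frakv1_eq χ c' j hy1 hP1, norm_mul, Complex.norm_real,
    Real.norm_of_nonneg (by rw [hlogP]; positivity), hlogP]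
  set A1 := ∑ m ∈ Finset.Ioc 0 ⌊bigP D ^ (0.504 : ℝ) / y⌋₊, twist χ (-β) m *
    (Real.log (bigP D ^ (0.504 : ℝ) / y / m) : ℂ) with hA1def
  set A2 := ∑ m ∈ Finset.Ioc 0 ⌊bigP D ^ (0.502 : ℝ) / y⌋₊, twist χ (-β) m *
    (Real.log (bigP D ^ (0.502 : ℝ) / y / m) : ℂ) with hA2def
  set A3 := ∑ m ∈ Finset.Ioc 0 ⌊bigP D ^ (0.5 : ℝ) / y⌋₊, twist χ (-β) m *
    (Real.log (bigP D ^ (0.5 : ℝ) / y / m) : ℂ) with hA3def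
  have e1 : ‖A1‖ ≤ CU * L ^ 2 := hb _ (by norm_num)
  have e2 : ‖2 * A2‖ ≤ 2 * (CU * L ^ 2) := by
    rw [norm_mul, Complex.norm_two]
    exact mul_le_mul_of_nonneg_left (hb _ (by norm_num)) zero_le_two
  have e3 : ‖A3‖ ≤ CU * L ^ 2 := hb _ (by norm_num)
  have h3 : ‖A1 - 2 * A2 + A3‖ ≤ 4 * (CU * L ^ 2) := by
    calc ‖A1 - 2 * A2 + A3‖ ≤ ‖A1 - 2 * A2‖ + ‖A3‖ := norm_add_le _ _
      _ ≤ (‖A1‖ + ‖2 * A2‖) + ‖A3‖ := add_le_add (norm_sub_le _ _) le_rfl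
      _ ≤ (CU * L ^ 2 + 2 * (CU * L ^ 2)) + CU * L ^ 2 := add_le_add (add_le_add e1 e2) e3
      _ = 4 * (CU * L ^ 2) := by ring
  calc 500 / L ^ 9 * ‖A1 - 2 * A2 + A3‖ ≤ 500 / L ^ 9 * (4 * (CU * L ^ 2)) :=
        mul_le_mul_of_nonneg_left h3 (by positivity)
    _ = 2000 * CU / L ^ 7 := by
        field_simp
        ring

/-- **(10.2)**: for `1 ≤ y ≤ P^{0.5}/T`, `𝔳₁ⱼ(y) ≪ T^{−1/2}` (only `m > P^{0.5}/y ≥ T` contribute;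
Pólya–Vinogradov and partial summation). [cite: Zhang2022LandauSiegel, §10 Lemma 10.1 (10.2)] -/
theorem range_one [NeZero D] (hprim : χ.IsPrimitive) {c' : ℝ} (hc' : 0 ≤ c')
    (hL : 1024 + (3 + 5 * c') * π ≤ Real.log D) {j : ℕ} (hj : j ∈ ({1, 2, 3} : Finset ℕ))
    {y : ℝ} (h1 : 1 ≤ y) (h2 : y ≤ bigP D ^ (0.5 : ℝ) / bigT D) :
    ‖frakv1 c' χ j y‖ ≤ 20 * bigT D ^ (-(1 / 2 : ℝ)) := by
  obtain ⟨hlogP, hT, hPa⟩ := params D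
  obtain ⟨hL200, hL3, hP1, hδre, hδn, hK4, hT9⟩ := setting (D := D) hc' hL hj
  have hK0 : 0 ≤ 3 + 5 * c' := by positivity
  obtain ⟨hD2, -, hDexp, hsqrt, hKπL⟩ := basics_of_large (D := D) hK0 hL200
  have hπ := Real.pi_pos
  set L : ℝ := Real.log D with hLdef
  set β : ℂ := betaJ c' D j with hβdef
  set P : ℝ := bigP D with hPdef
  have hL0 : 0 < L := by linarith
  have hL1 : 1 ≤ L := by linarith
  have hL1024 : 1024 ≤ L := by nlinarith
  have hP0 : 0 < P := by linarith
  have hPa0 : ∀ a : ℝ, 0 < P ^ a := fun a => Real.rpow_pos_of_pos hP0 a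
  have hT0 : 0 < bigT D := by rw [hT]; exact Real.exp_pos _
  have hy0 : 0 < y := by linarith
  have hD0 : (0 : ℝ) < D := by exact_mod_cast (by omega : 0 < D)
  have hL9 : 2000 ≤ L ^ 9 := by
    calc (2000 : ℝ) ≤ 3 ^ 9 := by norm_num
      _ ≤ L ^ 9 := pow_le_pow_left₀ (by norm_num) hL3 9
  -- the shift `s = β − 1`
  have hsre : (-1 - -β).re = -1 := by
    have : (-β).re = 0 := hδre
    simp only [Complex.sub_re, Complex.neg_re, Complex.one_re] at this ⊢
    linarith
  have hδ1 : ‖-β‖ ≤ 1 := by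
    refine hδn.trans ?_
    rw [div_le_one (by positivity)]
    calc (3 + 5 * c') * π ≤ L := hKπL
      _ = L ^ 1 := (pow_one L).symm
      _ ≤ L ^ 9 := pow_le_pow_right₀ hL1 (by norm_num)
  have hs2 : ‖(-1 : ℂ) - -β‖ ≤ 2 := by
    calc ‖(-1 : ℂ) - -β‖ ≤ ‖(-1 : ℂ)‖ + ‖-β‖ := norm_sub_le _ _
      _ ≤ 1 + 1 := by rw [norm_neg, norm_one]; exact add_le_add le_rfl hδ1
      _ = 2 := by norm_num
  -- rewrite `𝔳₁ⱼ(y)` as `Σ_{0<m≤Q−1} χ(m)a(m)`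
  set Q : ℕ := ⌈P⌉₊ with hQdef
  have hQ1 : 1 ≤ Q := Nat.one_le_ceil_iff.mpr hP0
  have hQP : P ≤ Q := Nat.le_ceil P
  set a : ℕ → ℂ := fun m => (m : ℂ) ^ (-1 - -β) * (ftilde (Real.log (y * m) / Real.log P) : ℂ)
    with hadef
  have hsum : frakv1 c' χ j y = ∑ m ∈ Finset.Ioc 0 (Q - 1), χ (m : ZMod D) * a m := by
    rw [frakv1, show Finset.Ico 1 Q = Finset.Ioc 0 (Q - 1) by
      rw [← Finset.Ico_add_one_add_one_eq_Ioc, zero_add, Nat.sub_add_cancel hQ1]]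
    refine Finset.sum_congr rfl fun m _ => ?_
    rw [hadef, div_eq_mul_inv, ← Complex.cpow_neg, show -(1 - β) = -1 - -β by ring]
    ring
  rw [hsum, SiegelZero.sum_Ioc_mul_eq_abel χ a (Nat.zero_le _), Nat.sub_add_cancel hQ1]
  -- the boundary term vanishes
  have haQ : a Q = 0 := by
    have hQ0 : (0 : ℝ) < Q := by exact_mod_cast (by omega : 0 < Q)
    have harg : 0.504 ≤ Real.log (y * Q) / Real.log P := by
      rw [hlogP, le_div_iff₀ (by positivity), Real.log_mul hy0.ne' hQ0.ne']
      have h1' : 0 ≤ Real.log y := Real.log_nonneg h1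
      have h2' : L ^ 9 ≤ Real.log Q := by
        calc L ^ 9 = Real.log P := hlogP.symm
          _ ≤ Real.log Q := Real.log_le_log hP0 hQP
      nlinarith [pow_pos hL0 9]
    rw [hadef]
    simp only
    rw [ftilde_eq_zero_of_ge harg]
    push_cast
    ring
  rw [haQ, mul_zero, zero_add]
  -- where the weights live: `X₃ = P^{0.5}/y ≥ T`
  set X3 : ℝ := P ^ (0.5 : ℝ) / y with hX3def
  set k0 : ℕ := ⌊X3⌋₊ with hk0def
  have hTX3 : bigT D ≤ X3 := by
    rw [hX3def, le_div_iff₀ hy0]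
    calc bigT D * y ≤ bigT D * (P ^ (0.5 : ℝ) / bigT D) :=
          mul_le_mul_of_nonneg_left h2 hT0.le
      _ = P ^ (0.5 : ℝ) := by field_simp
  have hT2 : (2 : ℝ) ≤ bigT D := by
    rw [hT]
    calc (2 : ℝ) ≤ 1 + 1 := by norm_num
      _ ≤ Real.exp 1 := by linarith [Real.add_one_le_exp (1 : ℝ)]
      _ ≤ Real.exp (L ^ (11 / 10 : ℝ)) := Real.exp_le_exp.mpr (Real.one_le_rpow hL1 (by norm_num))
  have hX3_2 : (2 : ℝ) ≤ X3 := hT2.trans hTX3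
  have hk0_2 : 2 ≤ k0 := Nat.le_floor (by exact_mod_cast hX3_2)
  have hk0X3 : (k0 : ℝ) ≤ X3 := Nat.floor_le (by linarith)
  have hX3k0 : X3 < k0 + 1 := Nat.lt_floor_add_one X3
  have hX3P : X3 ≤ P := by
    calc X3 ≤ P ^ (0.5 : ℝ) := div_le_self (hPa0 _).le h1
      _ ≤ P ^ (1 : ℝ) := Real.rpow_le_rpow_of_exponent_le hP1.le (by norm_num)
      _ = P := Real.rpow_one P
  have hk0Q : k0 - 1 ≤ Q - 1 := by
    have : k0 ≤ Q := (Nat.floor_le_floor hX3P).trans (Nat.floor_le_ceil P)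
    omega
  -- `f̃` vanishes at `m ≤ X₃`
  have hvan : ∀ m : ℕ, (m : ℝ) ≤ X3 → ftilde (Real.log (y * m) / Real.log P) = 0 := by
    intro m hm
    refine ftilde_eq_zero_of_le ?_
    rcases Nat.eq_zero_or_pos m with rfl | hm0
    · simp only [Nat.cast_zero, mul_zero, Real.log_zero, zero_div]; norm_num
    have hm0' : (0 : ℝ) < m := by exact_mod_cast hm0
    rw [hlogP, div_le_iff₀ (by positivity)]
    have : y * m ≤ P ^ (0.5 : ℝ) := by
      calc y * m ≤ y * X3 := mul_le_mul_of_nonneg_left hm hy0.le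
        _ = P ^ (0.5 : ℝ) := by rw [hX3def]; field_simp
    have := Real.log_le_log (by positivity) this
    rwa [hPa, Real.log_exp] at this
  rw [← Finset.sum_Ioc_consecutive _ (Nat.zero_le (k0 - 1)) hk0Q]
  have hfirst : ∑ n ∈ Finset.Ioc 0 (k0 - 1),
      (∑ k ∈ Finset.Ioc 0 n, χ (k : ZMod D)) * (a n - a (n + 1)) = 0 := by
    refine Finset.sum_eq_zero fun n hn => ?_
    rw [Finset.mem_Ioc] at hn
    have hn1 : ((n + 1 : ℕ) : ℝ) ≤ X3 := by
      have : n + 1 ≤ k0 := by omega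
      exact le_trans (by exact_mod_cast this) hk0X3
    have hn0 : (n : ℝ) ≤ X3 := le_trans (by push_cast; linarith) hn1
    rw [hadef]
    simp only
    rw [hvan n hn0, hvan (n + 1) hn1]
    push_cast
    ring
  rw [hfirst, zero_add]
  -- Pólya–Vinogradov on the rest
  set W : ℝ := Real.sqrt D * (1 + Real.log D) with hWdef
  have hW0 : 0 ≤ W := by positivity
  have hS : ∀ n : ℕ, ‖∑ k ∈ Finset.Ioc (0 : ℕ) n, χ (k : ZMod D)‖ ≤ W := fun n =>
    CharacterTails.norm_window_le_polyaVinogradov χ hprim hD2 0 n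
  have hdiff : ∀ n ∈ Finset.Ioc (k0 - 1) (Q - 1), ‖a n - a (n + 1)‖ ≤
      5 * (1 / ((n : ℝ) * (n + 1))) := by
    intro n hn
    rw [Finset.mem_Ioc] at hn
    have hn2 : 2 ≤ n := by omega
    rw [hadef]
    simp only
    calc _ ≤ 5 / ((n : ℝ) * (n + 1)) := norm_fweight_sub_succ_le hsre hs2 hy0 (hlogP ▸ hL9) hn2
      _ = 5 * (1 / ((n : ℝ) * (n + 1))) := by rw [mul_one_div]
  have htel := sum_Ioc_inv_mul_succ (k0 - 1) (Q - 1) hk0Q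
  have hk0cast : ((k0 - 1 : ℕ) : ℝ) + 1 = k0 := by
    rw [Nat.cast_sub (by omega : 1 ≤ k0)]; push_cast; ring
  have hk0pos : (0 : ℝ) < k0 := by exact_mod_cast (by omega : 0 < k0)
  have hbound : ‖∑ n ∈ Finset.Ioc (k0 - 1) (Q - 1),
      (∑ k ∈ Finset.Ioc 0 n, χ (k : ZMod D)) * (a n - a (n + 1))‖ ≤ 5 * W / k0 := by
    calc ‖∑ n ∈ Finset.Ioc (k0 - 1) (Q - 1),
          (∑ k ∈ Finset.Ioc 0 n, χ (k : ZMod D)) * (a n - a (n + 1))‖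
        ≤ ∑ n ∈ Finset.Ioc (k0 - 1) (Q - 1),
            ‖(∑ k ∈ Finset.Ioc 0 n, χ (k : ZMod D)) * (a n - a (n + 1))‖ := norm_sum_le _ _
      _ ≤ ∑ n ∈ Finset.Ioc (k0 - 1) (Q - 1), W * (5 * (1 / ((n : ℝ) * (n + 1)))) := by
          refine Finset.sum_le_sum fun n hn => ?_
          rw [norm_mul]
          exact mul_le_mul (hS n) (hdiff n hn) (norm_nonneg _) hW0
      _ = W * 5 * (1 / (((k0 - 1 : ℕ) : ℝ) + 1) - 1 / (((Q - 1 : ℕ) : ℝ) + 1)) := by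
          rw [← Finset.mul_sum, ← Finset.mul_sum, htel]; ring
      _ ≤ W * 5 * (1 / (((k0 - 1 : ℕ) : ℝ) + 1)) := by
          refine mul_le_mul_of_nonneg_left ?_ (by positivity)
          linarith [show (0 : ℝ) ≤ 1 / (((Q - 1 : ℕ) : ℝ) + 1) by positivity]
      _ = 5 * W / k0 := by rw [hk0cast]; ring
  refine hbound.trans ?_
  -- numerics: `5W/k₀ ≤ 10W/T ≤ 20D/T ≤ 20T^{-1/2}`
  have hk0T : bigT D ≤ 2 * k0 := by linarith
  have hW2D : W ≤ 2 * D := by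
    rw [hWdef, hsqrt]
    have h1' : 1 + L ≤ 2 * Real.exp (L / 2) := by linarith [Real.add_one_le_exp (L / 2)]
    calc Real.exp (L / 2) * (1 + L) ≤ Real.exp (L / 2) * (2 * Real.exp (L / 2)) :=
          mul_le_mul_of_nonneg_left h1' (Real.exp_pos _).le
      _ = 2 * (Real.exp (L / 2) * Real.exp (L / 2)) := by ring
      _ = 2 * D := by rw [← Real.exp_add, add_halves, ← hDexp]
  have hDT : (D : ℝ) ≤ bigT D * bigT D ^ (-(1 / 2 : ℝ)) := by
    rw [hT, ← Real.exp_mul, ← Real.exp_add, hDexp]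
    refine Real.exp_le_exp.mpr ?_
    have := two_mul_le_rpow hL1024
    linarith
  have hTpow0 : 0 < bigT D ^ (-(1 / 2 : ℝ)) := Real.rpow_pos_of_pos hT0 _
  rw [div_le_iff₀ hk0pos]
  calc 5 * W ≤ 5 * (2 * D) := by linarith
    _ ≤ 10 * (bigT D * bigT D ^ (-(1 / 2 : ℝ))) := by linarith
    _ = 20 * bigT D ^ (-(1 / 2 : ℝ)) * (bigT D / 2) := by ring
    _ ≤ 20 * bigT D ^ (-(1 / 2 : ℝ)) * k0 := by
        refine mul_le_mul_of_nonneg_left ?_ (by positivity)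
        linarith

/-! ### §8. Assembly: the skeleton node `Lemma101 c′` holds -/

/-- **Zhang (2022), Lemma 10.1 (`Z22:Lem10.1`, proof `Z22:Lem10.1.pf`; [Z22 p.53–54, (10.2)–(10.5),
tex L2723–2788]) is a theorem of the tree**: for `c′ ≥ 0` the skeleton node
`Skeleton.Lemma101 c′` HOLDS, with `c = 1/2` in (10.2). The proof writes the tent
`f̃ = 500((0.504−u)⁺ − 2(0.502−u)⁺ + (0.5−u)⁺)` (this is (10.6)), so that
`𝔳₁ⱼ(y) = (500/log P)Σ_k c_k Σ_{m≤X_k} χ(m)m^{β_j−1}log(X_k/m)`, `X_k = P^{a_k}/y`; the pieces with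
`T ≤ X_k ≤ P` are the tree's kernel form of the Lemma 8.2 contour argument
(`Lemma82.sum_twist_log_sub_main_le`, `= L′(1,χ)(1 − β_j log X_k) + O(𝓛⁻⁶)`), giving the printed
main terms of (10.3)–(10.4) exactly; (10.2) and the short pieces of (10.5) are Pólya–Vinogradov
with partial summation (tree `CharacterTails.norm_window_le_polyaVinogradov`), as printed. No
hypothesis beyond the node's own ((A), `χ` real primitive, `D` large).
[cite: Zhang2022LandauSiegel, §10 Lemma 10.1] -/
theorem lemma101_holds {c' : ℝ} (hc' : 0 ≤ c') : Lemma101 c' := by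
  set K : ℝ := 3 + 5 * c' with hK
  set CU : ℝ := 5 + 4 * K * π + 4 * Real.exp (9 / 2) * (1 + K * π) + C82 K with hCU
  have hπ := Real.pi_pos
  have hK0 : 0 ≤ K := by positivity
  have hC82 := C82_nonneg hK0
  have hCU0 : 0 ≤ CU := by positivity
  refine ⟨1 / 2, by norm_num, max 20 (max (1500 * C82 K) (2000 * CU)),
    ⌈Real.exp (1024 + K * π)⌉₊, fun D _ χ hD hq hp hA j hj y => ?_⟩
  have hexp : Real.exp (1024 + K * π) ≤ D := le_trans (Nat.le_ceil _) (by exact_mod_cast hD)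
  have hL : 1024 + (3 + 5 * c') * π ≤ Real.log D :=
    (Real.le_log_iff_exp_le (lt_of_lt_of_le (Real.exp_pos _) hexp)).mpr hexp
  have hL0 : 0 < Real.log D := by nlinarith
  have hA' : ‖χ.LFunction 1‖ ≤ 1 / Real.log D ^ 2022 := le_of_lt hA
  have hell : ell D = Real.log D := rfl
  have hC1 : (20 : ℝ) ≤ max 20 (max (1500 * C82 K) (2000 * CU)) := le_max_left _ _
  have hC2 : 1500 * C82 K ≤ max 20 (max (1500 * C82 K) (2000 * CU)) :=
    (le_max_left _ _).trans (le_max_right _ _)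
  have hC3 : 2000 * CU ≤ max 20 (max (1500 * C82 K) (2000 * CU)) :=
    (le_max_right _ _).trans (le_max_right _ _)
  refine ⟨fun h1 h2 => ?_, fun h1 h2 => ?_, fun h1 h2 => ?_, fun h => ?_⟩
  · refine (range_one χ hp hc' hL hj h1 h2).trans ?_
    have : 0 < bigT D ^ (-(1 / 2 : ℝ)) := Real.rpow_pos_of_pos (by rw [(params D).2.1]; exact Real.exp_pos _) _
    exact mul_le_mul_of_nonneg_right hC1 this.le
  · refine (range_two χ hp hc' hL hA' hj h1 h2).trans ?_
    rw [hell, div_eq_mul_inv]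
    exact mul_le_mul_of_nonneg_right hC2 (by positivity)
  · refine (range_three χ hp hc' hL hA' hj h1 h2).trans ?_
    rw [hell, div_eq_mul_inv]
    refine mul_le_mul_of_nonneg_right (le_trans ?_ hC2) (by positivity)
    nlinarith
  · have hy : bigP D ^ (0.5 : ℝ) / bigT D < y := by
      obtain ⟨hlogP, hT, hPa⟩ := params D
      have hT0 : 0 < bigT D := by rw [hT]; exact Real.exp_pos _
      have hmono : ∀ a b : ℝ, a ≤ b → bigP D ^ a / bigT D ≤ bigP D ^ b / bigT D := by
        intro a b hab
        refine div_le_div_of_nonneg_right ?_ hT0.le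
        rw [hPa, hPa]
        exact Real.exp_le_exp.mpr (mul_le_mul_of_nonneg_right hab (by positivity))
      rcases h with ⟨h1, -⟩ | ⟨h1, -⟩ | ⟨h1, -⟩
      · exact h1
      · exact lt_of_le_of_lt (hmono _ _ (by norm_num)) h1
      · exact lt_of_le_of_lt (hmono _ _ (by norm_num)) h1
    refine (range_four χ hp hc' hL hA' hj hy).trans ?_
    rw [hell, div_eq_mul_inv]
    exact mul_le_mul_of_nonneg_right hC3 (by positivity)

end Literature.NumberTheory.LFunctions.Zhang2022.Lemma101

namespace Literature.NumberTheory.LFunctions.Zhang2022.Skeleton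

/-- **`Z22:Lem10.1` discharged** [Z22 p.53, Lemma 10.1, tex L2723–2749; proof `Z22:Lem10.1.pf`
tex L2751–2788]: the skeleton node `Lemma101 c′` (Zhang's Lemma 10.1, the four ranges
(10.2)–(10.5) for `𝔳₁ⱼ(y)`) HOLDS for every `c′ ≥ 0`, with no hypothesis beyond the node's own —
kernel alias of `Lemma101.lemma101_holds`. [cite: Zhang2022LandauSiegel, §10 Lemma 10.1] -/
theorem lemma101_holds {c' : ℝ} (hc' : 0 ≤ c') : Lemma101 c' := Lemma101.lemma101_holds hc'

end Literature.NumberTheory.LFunctions.Zhang2022.Skeleton
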